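import Mathlib
import Literature.MathematicalPhysics.QuantumFieldTheory.Balaban1983to89.B5Action121

/-!
# B5 (1.18)/(1.20): the block averages `Q_k`, `Q′_k` in position space and their momentum
# representations (1.30)/(1.61) — `u_k(p) = Π_μ ∂¹_μ(p′)/∂_μ(p)`, `v_μ(p) = ∂¹_μ(p′)/∂_μ(p)`

Source: T. Bałaban, *Propagators and renormalization transformations for lattice gauge
theories. I*, Commun. Math. Phys. 95 (1984) 17–40 (`Balaban1984PropagatorsI`, "B5"), renders
`b2b-balaban-ref1/pages/1984-cmp95-propagators-rt-I/…-pNNN-x2.png` (PDF page = journal page − 16),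
read as images.

## What the paper prints (verbatim)

* p. 18 [PDF 2], (1.6): «We define a new lattice T_L^{(1)} = T₁ ∩ Lℤ^d and we divide T₁ into
  blocks B(y) parametrized by the points of T_L^{(1)}:
  B(y) = {x ∈ T₁ : y_μ ≦ x_μ < y_μ + L, μ = 1, …, d}, y ∈ T_L^{(1)}. (1.6)»
* p. 19 [PDF 3], after (1.8): «where A(Γ) = Σ_{b⊂Γ} A_b for arbitrary contour Γ, and x(c) denotes
  a point in the block B(c₊) obtained by translation of x by the bond c, so if c = ⟨y, y + Le_μ⟩
  then x(c) = x + Le_μ.»; (1.11): «(QA)_c = Σ_{x∈B(c₋)} L^{−(d+1)}A([x, x(c)])»; (1.13):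
  «B^λ_c = B_c − L^{−1}(Σ_{x∈B(c₊)} L^{−d}λ(x) − Σ_{x∈B(c₋)} L^{−d}λ(x))
  = B_c − L^{−1}((Q′λ)(c₊) − (Q′λ)(c₋)) = B_c − (∂Q′λ)(c). (1.13)»
* p. 20 [PDF 4]: «Q₂ is defined as Q only with the number L replaced by L² in all definitions.
  It is easily seen that a composition of k transformations is given by … (1.17) where
  (Q_kA)_b = Σ_{x∈B^k(b₋)} η^{d+1}A([x, x(b)]), b ⊂ T₁^{(k)} = ℤ^d ∩ T_η, η = L^{−k}, (1.18)
  and x(b) is a point in B^k(b₊) obtained from x by translation by b. If b = ⟨y, y + e_μ⟩,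
  then x(b) = x + e_μ.»; «Under a gauge transformation λ the field A and the averaged field Q_kA
  transform as follows
  A^λ = A − ∂^ηλ, (Q_kA^λ)_b = (Q_kA)_b − (Σ_{x∈B^k(b₊)} η^dλ(x) − Σ_{x∈B^k(b₋)} η^dλ(x)),
  b ⊂ T₁^{(k)}, (1.20)
  or denoting (Q′_kλ)(y) = Σ_{x∈B^k(y)} η^dλ(x), we have Q_kA^λ = Q_kA − ∂Q′_kλ.
  The δ-function δ(B − Q_kA) is invariant with respect to gauge transformations λ satisfying
  Q′_kλ = 0».
* p. 23 [PDF 7]: (1.29) «f̃(p) = Σ_{x∈T′_η} η^d e^{−ip·x} f(x), p ∈ T̃′_η»; (1.30): «Δ²(p)λ̃(p) −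
  Δ(p)(∂*A)~(p) + \overline{u_k(p)} ω̃(p′) = 0, Σ_l u_k(p′+l) λ̃(p′+l) = 0»; (1.31): «Δ(p) =
  Σ_{μ=1}^d |∂_μ(p)|², ∂_μ(p) = (e^{iηp_μ} − 1)/η, u_k(p) = Π_μ ∂¹_μ(p′)/∂_μ(p)»; «p ∈ T̃_η is
  represented as a sum p = p′ + l, p′ ∈ T̃₁^{(k)} and l = (l₁,…,l_d), l_μ = 2πm_μ, m_μ is an
  integer»; «Because u_k(l) = 0 for l ≠ 0, u_k(0) = 1».
* p. 28 [PDF 12], (1.61): «(Q_k A)~_μ(p′) = Σ_l u(p′+l) v_μ(p′+l) Ã_μ(p′+l),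
  v_μ(p) = ∂¹_μ(p′)/∂_μ(p)».

## What is typed here (dictionary)

The `η`-lattice torus is `Tor (fine n M)` of `B5Prop11Plancherel` (`N_μ = n·M_μ` sites per
direction, `n = η⁻¹ = L^k`), the unit lattice `T₁^{(k)}` is `Tor M`, and the unit-lattice point `y`
sits in the fine torus at `up y = n·y`.  The block of (1.6)/(1.18) is
`B^k(y) = {up y + ι j : j ∈ {0,…,n−1}^d}` (`bpt y j`; «y_μ ≦ x_μ < y_μ + 1» in `η`-units), the
straight contour `[x, x + e_μ]` consists of the `n` bonds `⟨x + tηe_μ, x + (t+1)ηe_μ⟩`,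
`t = 0,…,n−1`, so «A([x, x(b)]) = Σ_{b′⊂[x,x+e_μ]} A_{b′}» is `lineSum A x μ = Σ_t A_μ(x + tηe_μ)`
(`tstep μ t = tηe_μ`).  Then
* `QsOp` is «(Q′_kλ)(y) = Σ_{x∈B^k(y)} η^dλ(x)» (`QsOp_mulVec`), a matrix `Tor M ← Tor (fine n M)`;
* `QvOp` is (1.18) «(Q_kA)_b = Σ_{x∈B^k(b₋)} η^{d+1}A([x, x(b)])», `b = ⟨y, y+e_μ⟩ ↔ (y, μ)`
  (`QvOp_mulVec`), a matrix `Tor M × Fin d ← Tor (fine n M) × Fin d`;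
* the gauge transformation «A^λ = A − ∂^ηλ» is `B5Action121.gaugeT (fine n M) n A λ` (lattice factor
  `η⁻¹ = n`), and «∂Q′_kλ» is `B5Action121.GradOp M 1 *ᵥ (QsOp *ᵥ λ)` (unit lattice, factor `1`);
* momenta: the coarse class `q ∈ Tor M` is `p′` (`p′_ν = 2πv(q_ν)/M_ν = sOf M q ν`), the offset
  `k ∈ {0,…,n−1}^d` is `l = 2πk`, and `pOf (k, q)` is the fine momentum `p′ + l`
  (`= (B5Prop11Plancherel.emb ((k, μ), q)).1`, `emb_eq`); the transforms are the normalised DFT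
  matrices `dft M`, `dft (fine n M)` of pass 4 ((1.29) up to constants);
* the printed functions are those of `B5Prop11Fiber`: `uSym n k (sOf M q)` = `u_k(p′+l)`,
  `vSym n k (sOf M q) μ` = `v_μ(p′+l)`, `dSym` = `∂_μ(p′+l)`, `d1Sym` = `∂¹_μ(p′)` — including their
  value `1` at the removable singularity `∂_μ(p′+l) = 0`.

## What is certified (kernel-checked, zero sorry)

* `QsOp_mulVec`, `QvOp_mulVec`: the typed operators ARE the printed sums (1.18) and the display
  after (1.20).
* (1.20): `QvOp_gaugeT` — «(Q_kA^λ)_b = (Q_kA)_b − (Σ_{x∈B^k(b₊)} η^dλ(x) − Σ_{x∈B^k(b₋)} η^dλ(x))»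
  (telescoping of `∂^ηλ` along `[x, x + e_μ]` and `B^k(y) + e_μ = B^k(y + e_μ)`), and
  `QvOp_gaugeT_eq` — «Q_kA^λ = Q_kA − ∂Q′_kλ».
* (1.30)/(1.61) — THE MOMENTUM REPRESENTATIONS, derived (Fourier inversion on the fine torus,
  character orthogonality on the unit torus, and the geometric sums
  `(1/n) Σ_{t<n} e^{itη(p′_ν+l_ν)} = ∂¹_ν(p′)/∂_ν(p′+l)` (`avg_om`),
  `n^{−d} Σ_{j} e^{iη(p′+l)·j} = u(p′+l)` (`sum_chi_iota`)):
  `dft_QsOp`: `(Q′f)^(p′) = c · Σ_l u(p′+l) f^(p′+l)`;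
  `dft_QvOp`: `(Q A)^_μ(p′) = c · Σ_l u(p′+l) v_μ(p′+l) Â_μ(p′+l)`,
  for every `d`, `n ≥ 1`, torus `M`, every (complex) `f`, `A`, with the constant
  `c = cQ n M = (√(n^d))⁻¹` (`cQ_eq`) coming from the unitary normalisation of the two DFTs
  (B5's own normalisations (1.29) — weight `η^d` on `T_η`, weight `1` on the unit lattice — give
  `c = 1`).
* «u_k(l) = 0 for l ≠ 0, u_k(0) = 1»: `uSym_sOf_zero`.
* supporting identities: `chi_pOf_up` (`e^{i(p′+l)·(ny)} = e^{ip′·y}`), `chi_pOf_tstep`,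
  `om_pow` (`e^{iη(p′_ν+l_ν)·n} = e^{ip′_ν}`), `dSym_eq_om`, `d1Sym_eq_om`, `pOf_bijective`
  (every fine momentum is a unique `p′ + l`), `dft_inversion`.

## What is NOT certified here

* That the blocks `B^k(y)` PARTITION the fine torus (injectivity/surjectivity of `(y, j) ↦ bpt y j`)
  — not needed for the identities above, which hold as stated; the blocks are DEFINED as the images
  `j ↦ up y + ι j`, which is (1.6) read in `η`-units.
* The first equation of (1.30) and the rest of Sect. C (the variational equations (1.22)–(1.28));
  the operator `P` of (1.69)/(1.70); the identification of pass 5's `calDa` `Q*Q`-term with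
  `a·(QvOp)ᴴ QvOp` at the operator level (the symbol-level statement is `dft_QvOp`).
* Fields are complex (B5: real); all statements specialise.
-/

open scoped BigOperators Matrix ComplexConjugate
open Finset Complex

namespace Literature.MathematicalPhysics.QuantumFieldTheory.Balaban1983to89.B5Block118

open Literature.MathematicalPhysics.QuantumFieldTheory.Balaban1983to89.B4Strip
open Literature.MathematicalPhysics.QuantumFieldTheory.Balaban1983to89.B5Prop11Fiber
open Literature.MathematicalPhysics.QuantumFieldTheory.Balaban1983to89.B5Prop11Plancherel
open Literature.MathematicalPhysics.QuantumFieldTheory.Balaban1983to89.B5Action121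

noncomputable section

/-! ## §1. Tools: Fourier inversion, telescoping, character facts on one torus -/

section Tools

variable {d : ℕ} (N : Fin d → ℕ) [hN : ∀ μ, NeZero (N μ)]

/-- the DFT normalisation `|T|^{-1/2}`. [folklore] -/
def cT : ℝ := (Real.sqrt (Fintype.card (Tor N)))⁻¹

/-- entries of the DFT. [folklore] -/
theorem dft_apply' (p x : Tor N) : dft N p x = (cT N : ℂ) * conj (chi N p x) := rfl

/-- `conj F_{p,x} = |T|^{-1/2} e^{ip·x}`. [folklore] -/
theorem conj_dft (p x : Tor N) : conj (dft N p x) = (cT N : ℂ) * chi N p x := by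
  rw [dft_apply', map_mul, Complex.conj_ofReal, Complex.conj_conj]

/-- `e^{ip·0} = 1`. [folklore] -/
theorem chi_zero_right (p : Tor N) : chi N p 0 = 1 := by
  unfold chi
  simp

/-- Fourier inversion `f(x) = Σ_p conj(F_{p,x}) f^(p)` (`F^*F = 1`). [folklore] -/
theorem dft_inversion (g : Tor N → ℂ) (x : Tor N) :
    g x = ∑ p, conj (dft N p x) * (dft N *ᵥ g) p := by
  have h1 : star (dft N) * dft N = 1 :=
    Matrix.mem_unitaryGroup_iff'.mp (dft_mem_unitaryGroup N)
  have h2 : (star (dft N) * dft N) *ᵥ g = g := by rw [h1, Matrix.one_mulVec]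
  conv_lhs => rw [← h2]
  rw [← Matrix.mulVec_mulVec]
  simp only [Matrix.mulVec, dotProduct, Matrix.star_apply, Complex.star_def]

/-- character orthogonality in the form `Σ_y conj(e^{iq·y}) e^{iq′·y} = |T| δ_{q,q′}`. [folklore] -/
theorem sum_conj_chi_mul_chi (q q' : Tor N) :
    ∑ y, conj (chi N q y) * chi N q' y = if q' = q then (Fintype.card (Tor N) : ℂ) else 0 := by
  have h : ∀ y, conj (chi N q y) * chi N q' y = chi N (-q + q') y := by
    intro y
    rw [conj_chi, chi_add_left]
  simp_rw [h]
  rw [sum_chi]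
  simp only [neg_add_eq_zero]
  by_cases hq : q' = q
  · subst hq
    simp
  · rw [if_neg (fun h => hq h.symm), if_neg hq]

/-- the lattice vector `t e_μ` (`t` fine steps in direction `μ`). [folklore] -/
def tstep (μ : Fin d) (t : ℕ) : Tor N := fun ν => if ν = μ then (t : ZMod (N ν)) else 0

omit hN in
/-- `0·e_μ = 0`. [folklore] -/
theorem tstep_zero (μ : Fin d) : tstep N μ 0 = 0 := by
  funext ν
  simp [tstep]

omit hN in
/-- `(t+1)e_μ = te_μ + e_μ`. [folklore] -/
theorem tstep_succ (μ : Fin d) (t : ℕ) : tstep N μ (t + 1) = tstep N μ t + unitVec N μ := by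
  funext ν
  by_cases h : ν = μ
  · subst h
    simp [tstep, unitVec]
  · simp [tstep, unitVec, h]

/-- telescoping along a line of `n` bonds. [folklore] -/
theorem sum_fin_telescope (g : ℕ → ℂ) (n : ℕ) :
    ∑ t : Fin n, (g ((t : ℕ) + 1) - g t) = g n - g 0 := by
  rw [Fin.sum_univ_eq_sum_range (fun t => g (t + 1) - g t) n, Finset.sum_range_sub]

end Tools

/-! ## §2. Block geometry: `T₁^{(k)} ↪ T_η`, blocks `B^k(y)` ((1.6)/(1.18)), fine momenta `p′ + l` -/

section Geometry

variable {d : ℕ} (n : ℕ) [NeZero n] (M : Fin d → ℕ) [hM : ∀ μ, NeZero (M μ)]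

/-- multiplication by `n = η⁻¹`: `ℤ → ℤ/(nM_ν)`. [folklore] -/
def upZ (ν : Fin d) : ℤ →+ ZMod (fine n M ν) where
  toFun z := (n : ZMod (fine n M ν)) * (z : ZMod (fine n M ν))
  map_zero' := by simp
  map_add' a b := by
    push_cast
    ring

omit [NeZero n] hM in
/-- `upZ z = n·z`. [folklore] -/
theorem upZ_apply (ν : Fin d) (z : ℤ) :
    upZ n M ν z = (n : ZMod (fine n M ν)) * (z : ZMod (fine n M ν)) := rfl

omit [NeZero n] hM in
/-- `n·M_ν = 0` in `ℤ/(nM_ν)`. [folklore] -/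
theorem upZ_M (ν : Fin d) : upZ n M ν (M ν : ℤ) = 0 := by
  rw [upZ_apply, Int.cast_natCast, ← Nat.cast_mul]
  exact ZMod.natCast_self (n * M ν)

/-- the embedding `y_ν ↦ n·y_ν` of `ℤ/M_ν` into `ℤ/(nM_ν)` (a unit-lattice coordinate read on the
`η`-lattice). [folklore] -/
def upHom (ν : Fin d) : ZMod (M ν) →+ ZMod (fine n M ν) :=
  ZMod.lift (M ν) ⟨upZ n M ν, upZ_M n M ν⟩

omit [NeZero n] hM in
/-- `upHom (z mod M) = n·z mod nM`. [folklore] -/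
theorem upHom_intCast (ν : Fin d) (z : ℤ) :
    upHom n M ν (z : ZMod (M ν)) = (n : ZMod (fine n M ν)) * (z : ZMod (fine n M ν)) := by
  rw [upHom, ZMod.lift_coe]
  rfl

/-- the unit-lattice point `y ∈ T₁^{(k)}` as a point of `T_η` («T₁^{(k)} = ℤ^d ∩ T_η», (1.18)).
[cite: Balaban1984PropagatorsI, (1.18) p.20] -/
def up (y : Tor M) : Tor (fine n M) := fun ν => upHom n M ν (y ν)

omit [NeZero n] hM in
/-- `up` is additive. [folklore] -/
theorem up_add (y y' : Tor M) : up n M (y + y') = up n M y + up n M y' := by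
  funext ν
  simp [up]

omit [NeZero n] hM in
/-- `up e_μ = n·(ηe_μ)`: one unit-lattice step is `n` fine steps. [folklore] -/
theorem up_unitVec (μ : Fin d) : up n M (unitVec M μ) = tstep (fine n M) μ n := by
  funext ν
  simp only [up, unitVec, tstep]
  by_cases h : ν = μ
  · subst h
    rw [Pi.single_eq_same, if_pos rfl,
      show (1 : ZMod (M ν)) = ((1 : ℤ) : ZMod (M ν)) by rw [Int.cast_one],
      upHom_intCast, Int.cast_one, mul_one]
  · rw [Pi.single_eq_of_ne h, if_neg h, map_zero]

/-- the offset `ηj`, `j ∈ {0,…,n−1}^d`, inside a block. [folklore] -/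
def iota (j : Fin d → Fin n) : Tor (fine n M) := fun ν => ((j ν : ℕ) : ZMod (fine n M ν))

/-- the points of the block `B^k(y) = {x : y_μ ≦ x_μ < y_μ + 1}` ((1.6) with `L` replaced by `L^k`,
in `η`-units): `x = n·y + j`, `0 ≤ j_μ < n`. [cite: Balaban1984PropagatorsI, (1.6) p.18] -/
def bpt (y : Tor M) (j : Fin d → Fin n) : Tor (fine n M) := up n M y + iota n M j

/-- the fine momentum `p = p′ + l` of the coarse class `q` (`p′`) and offset `k` (`l = 2πk`):
index `v(q_ν) + M_ν k_ν mod nM_ν` («p ∈ T̃_η is represented as a sum p = p′ + l», p. 23).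
[cite: Balaban1984PropagatorsI, (1.31) p.23] -/
def pOf (kq : (Fin d → Fin n) × Tor M) : Tor (fine n M) :=
  fun ν => (((kq.2 ν).valMinAbs + (M ν : ℤ) * ((kq.1 ν : ℕ) : ℤ) : ℤ) : ZMod (fine n M ν))

omit [NeZero n] hM in
/-- pass 4's coset parametrisation is `(pOf, component)`. [folklore] -/
theorem emb_eq (k : Fin d → Fin n) (μ : Fin d) (q : Tor M) :
    B5Prop11Plancherel.emb n M ((k, μ), q) = (pOf n M (k, q), μ) := rfl

omit [NeZero n] in
/-- `(k, q) ↦ p′ + l` is injective. [folklore] -/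
theorem pOf_injective : Function.Injective (pOf n M) := by
  rintro ⟨k, q⟩ ⟨k', q'⟩ h
  rcases isEmpty_or_nonempty (Fin d) with hd | ⟨⟨μ⟩⟩
  · exact Prod.ext (funext fun ν => isEmptyElim ν) (funext fun ν => isEmptyElim ν)
  · have h2 : B5Prop11Plancherel.emb n M ((k, μ), q) = B5Prop11Plancherel.emb n M ((k', μ), q') := by
      rw [emb_eq, emb_eq, h]
    have h3 := B5Prop11Plancherel.emb_injective n M h2
    simp only [Prod.mk.injEq] at h3
    exact Prod.ext h3.1.1 h3.2

/-- `|{0,…,n−1}^d × T₁| = |T_η|`. [folklore] -/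
theorem card_kq : Fintype.card ((Fin d → Fin n) × Tor M) = Fintype.card (Tor (fine n M)) := by
  simp only [Fintype.card_prod, Fintype.card_pi, Fintype.card_fin, ZMod.card, Finset.prod_const,
    Finset.card_univ, fine]
  rw [Finset.prod_mul_distrib, Finset.prod_const, Finset.card_univ, Fintype.card_fin]

/-- every fine momentum is a unique `p′ + l`. [folklore] -/
theorem pOf_bijective : Function.Bijective (pOf n M) :=
  (Fintype.bijective_iff_injective_and_card _).mpr ⟨pOf_injective n M, card_kq n M⟩

/-- `|T_η| = n^d |T₁|`. [folklore] -/
theorem card_fine : (Fintype.card (Tor (fine n M)) : ℝ) = (n : ℝ) ^ d * Fintype.card (Tor M) := by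
  rw [← card_kq n M]
  simp only [Fintype.card_prod, Fintype.card_pi, Fintype.card_fin, Finset.prod_const,
    Finset.card_univ]
  push_cast
  ring

end Geometry

/-! ## §3. Characters at `p′ + l`: `e^{i(p′+l)·ny} = e^{ip′·y}`, `e^{iη(p′_ν+l_ν)t}` -/

section Characters

variable {d : ℕ} (n : ℕ) [NeZero n] (M : Fin d → ℕ) [hM : ∀ μ, NeZero (M μ)]

/-- `ω_ν = e^{iη(p′_ν + l_ν)}` (so that `∂_ν(p′+l) = η⁻¹(ω_ν − 1)`). [folklore] -/
def om (k : Fin d → Fin n) (s : Fin d → ℝ) (ν : Fin d) : ℂ :=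
  Complex.exp (((shiftr n k s ν / n : ℝ) : ℂ) * I)

omit [NeZero n] in
/-- `∂_ν(p′+l) = n(ω_ν − 1)`. [cite: Balaban1984PropagatorsI, (1.31) p.23] -/
theorem dSym_eq_om (k : Fin d → Fin n) (s : Fin d → ℝ) (ν : Fin d) :
    dSym n k s ν = (n : ℂ) * (om n k s ν - 1) := rfl

/-- `ω_ν^n = e^{ip′_ν}` (`l_ν n η = 2πk_ν`). [folklore] -/
theorem om_pow (k : Fin d → Fin n) (s : Fin d → ℝ) (ν : Fin d) :
    om n k s ν ^ n = Complex.exp (((s ν : ℝ) : ℂ) * I) := by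
  rw [om, ← Complex.exp_nat_mul, Complex.exp_eq_exp_iff_exists_int]
  refine ⟨((k ν : ℕ) : ℤ), ?_⟩
  have hn : (n : ℂ) ≠ 0 := by exact_mod_cast NeZero.ne n
  unfold shiftr
  push_cast
  field_simp

/-- `∂¹_ν(p′) = ω_ν^n − 1`. [cite: Balaban1984PropagatorsI, (1.31) p.23] -/
theorem d1Sym_eq_om (k : Fin d → Fin n) (s : Fin d → ℝ) (ν : Fin d) :
    d1Sym s ν = om n k s ν ^ n - 1 := by
  rw [om_pow, d1Sym]

/-- `e^{2πi (v + Mk) t/(nM)} = ω_ν^t`: the fine character of `p′ + l` at `t` fine steps.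
[folklore] -/
theorem stdAddChar_pOf_mul_natCast (k : Fin d → Fin n) (q : Tor M) (ν : Fin d) (t : ℕ) :
    (ZMod.stdAddChar (N := fine n M ν)) (pOf n M (k, q) ν * (t : ZMod (fine n M ν)))
      = om n k (sOf M q) ν ^ t := by
  have hMc : (M ν : ℂ) ≠ 0 := by exact_mod_cast NeZero.ne (M ν)
  have hnc : (n : ℂ) ≠ 0 := by exact_mod_cast NeZero.ne n
  have h1 : pOf n M (k, q) ν * (t : ZMod (fine n M ν))
      = ((((q ν).valMinAbs + (M ν : ℤ) * ((k ν : ℕ) : ℤ)) * (t : ℤ) : ℤ) : ZMod (fine n M ν)) := by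
    simp only [pOf]
    push_cast
    ring
  rw [h1, ZMod.stdAddChar_coe, om, ← Complex.exp_nat_mul]
  congr 1
  unfold shiftr sOf
  simp only [fine]
  push_cast
  field_simp

/-- `e^{i(p′+l)·(ny)} = e^{ip′·y}` factorwise. [folklore] -/
theorem stdAddChar_pOf_up (k : Fin d → Fin n) (q y : Tor M) (ν : Fin d) :
    (ZMod.stdAddChar (N := fine n M ν)) (pOf n M (k, q) ν * up n M y ν)
      = (ZMod.stdAddChar (N := M ν)) (q ν * y ν) := by
  have hMc : (M ν : ℂ) ≠ 0 := by exact_mod_cast NeZero.ne (M ν)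
  have hnc : (n : ℂ) ≠ 0 := by exact_mod_cast NeZero.ne n
  have hy : y ν = (((y ν).val : ℤ) : ZMod (M ν)) := by
    rw [Int.cast_natCast, ZMod.natCast_zmod_val]
  have hq : q ν = (((q ν).valMinAbs : ℤ) : ZMod (M ν)) := by rw [ZMod.coe_valMinAbs]
  have hup : up n M y ν = (n : ZMod (fine n M ν)) * (((y ν).val : ℤ) : ZMod (fine n M ν)) := by
    show upHom n M ν (y ν) = _
    conv_lhs => rw [hy]
    exact upHom_intCast n M ν _
  have h1 : pOf n M (k, q) ν * up n M y ν
      = ((((q ν).valMinAbs + (M ν : ℤ) * ((k ν : ℕ) : ℤ)) * ((n : ℤ) * ((y ν).val : ℤ)) : ℤ) :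
          ZMod (fine n M ν)) := by
    rw [hup]
    simp only [pOf]
    push_cast
    ring
  have h2 : q ν * y ν = ((((q ν).valMinAbs * ((y ν).val : ℤ) : ℤ)) : ZMod (M ν)) := by
    conv_lhs => rw [hq, hy]
    push_cast
    ring
  rw [h1, h2, ZMod.stdAddChar_coe, ZMod.stdAddChar_coe, Complex.exp_eq_exp_iff_exists_int]
  refine ⟨((k ν : ℕ) : ℤ) * ((y ν).val : ℤ), ?_⟩
  simp only [fine]
  push_cast
  field_simp

/-- `e^{i(p′+l)·(ny)} = e^{ip′·y}` (`l·y ∈ 2πℤ`). [folklore] -/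
theorem chi_pOf_up (k : Fin d → Fin n) (q y : Tor M) :
    chi (fine n M) (pOf n M (k, q)) (up n M y) = chi M q y := by
  unfold chi
  exact Finset.prod_congr rfl fun ν _ => stdAddChar_pOf_up n M k q y ν

/-- `e^{i(p′+l)·(tηe_μ)} = ω_μ^t`. [folklore] -/
theorem chi_pOf_tstep (k : Fin d → Fin n) (q : Tor M) (μ : Fin d) (t : ℕ) :
    chi (fine n M) (pOf n M (k, q)) (tstep (fine n M) μ t) = om n k (sOf M q) μ ^ t := by
  unfold chi tstep
  rw [Finset.prod_eq_single μ]
  · rw [if_pos rfl]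
    exact stdAddChar_pOf_mul_natCast n M k q μ t
  · intro ν _ hν
    rw [if_neg hν, mul_zero, AddChar.map_zero_eq_one]
  · intro h
    exact absurd (Finset.mem_univ μ) h

/-- `e^{i(p′+l)·ηj} = Π_ν ω_ν^{j_ν}`. [folklore] -/
theorem chi_pOf_iota (k : Fin d → Fin n) (q : Tor M) (j : Fin d → Fin n) :
    chi (fine n M) (pOf n M (k, q)) (iota n M j) = ∏ ν, om n k (sOf M q) ν ^ (j ν : ℕ) := by
  unfold chi iota
  exact Finset.prod_congr rfl fun ν _ => stdAddChar_pOf_mul_natCast n M k q ν (j ν)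

omit hM in
/-- THE GEOMETRIC SUM: `Σ_{t<n} ω_ν^t = n · v_ν(p′+l)`, i.e. `(1/n)Σ_{t<n} e^{iηp_ν t} =
∂¹_ν(p′)/∂_ν(p)` (with the value `1` at `∂_ν(p) = 0`, where `ω_ν = 1`).
[cite: Balaban1984PropagatorsI, (1.61) p.28] -/
theorem avg_om (k : Fin d → Fin n) (q : Tor M) (ν : Fin d) :
    (∑ t : Fin n, om n k (sOf M q) ν ^ (t : ℕ)) = (n : ℂ) * vSym n k (sOf M q) ν := by
  have hnc : (n : ℂ) ≠ 0 := by exact_mod_cast NeZero.ne n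
  rw [Fin.sum_univ_eq_sum_range (fun t => om n k (sOf M q) ν ^ t) n]
  by_cases h : om n k (sOf M q) ν = 1
  · have hd : dSym n k (sOf M q) ν = 0 := by rw [dSym_eq_om, h, sub_self, mul_zero]
    rw [vSym, if_pos hd, h]
    simp
  · have h' : om n k (sOf M q) ν - 1 ≠ 0 := sub_ne_zero.mpr h
    have hd : dSym n k (sOf M q) ν ≠ 0 := by
      rw [dSym_eq_om]
      exact mul_ne_zero hnc h'
    rw [geom_sum_eq h, vSym, if_neg hd, d1Sym_eq_om n k, dSym_eq_om]
    field_simp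

/-- THE BLOCK SUM: `Σ_{j∈{0,…,n−1}^d} e^{i(p′+l)·ηj} = n^d u(p′+l)`, `u = Π_ν v_ν` ((1.31)).
[cite: Balaban1984PropagatorsI, (1.31) p.23] -/
theorem sum_chi_iota (k : Fin d → Fin n) (q : Tor M) :
    ∑ j : Fin d → Fin n, chi (fine n M) (pOf n M (k, q)) (iota n M j)
      = (n : ℂ) ^ d * uSym n k (sOf M q) := by
  simp_rw [chi_pOf_iota]
  rw [← Fintype.piFinset_univ, ← Finset.prod_univ_sum (fun _ => (Finset.univ : Finset (Fin n)))
    (fun ν (t : Fin n) => om n k (sOf M q) ν ^ (t : ℕ))]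
  simp_rw [avg_om]
  rw [Finset.prod_mul_distrib, Finset.prod_const, Finset.card_univ, Fintype.card_fin, uSym]

omit hM in
/-- «u_k(l) = 0 for l ≠ 0, u_k(0) = 1» (at `p′ = 0`). [cite: Balaban1984PropagatorsI, (1.31) p.23] -/
theorem uSym_sOf_zero (k : Fin d → Fin n) :
    uSym n k (sOf M (0 : Tor M)) = if k = 0 then 1 else 0 := by
  have hn1 : 1 ≤ n := Nat.one_le_iff_ne_zero.mpr (NeZero.ne n)
  have hpi : ∀ ν, |(0 : Fin d → ℝ) ν| ≤ Real.pi := fun ν => by simp [Real.pi_nonneg]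
  rw [sOf_zero]
  by_cases hk : k = 0
  · subst hk
    rw [if_pos rfl, uSym]
    refine Finset.prod_eq_one fun ν _ => ?_
    have hd : dSym n 0 (0 : Fin d → ℝ) ν = 0 := (dSym_eq_zero_iff n hn1 0 0 ν (hpi ν)).mpr ⟨rfl, rfl⟩
    rw [vSym, if_pos hd]
  · rw [if_neg hk, uSym]
    obtain ⟨ν, hν⟩ : ∃ ν, k ν ≠ 0 := Function.ne_iff.mp hk
    refine Finset.prod_eq_zero (Finset.mem_univ ν) ?_
    have hd : dSym n k 0 ν ≠ 0 := fun h => hν ((dSym_eq_zero_iff n hn1 k 0 ν (hpi ν)).mp h).2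
    rw [vSym, if_neg hd, d1Sym]
    simp

end Characters

/-! ## §4. The block averages `Q′_k` (scalar) and `Q_k` ((1.18), vector) in position space; (1.20) -/

section Averages

variable {d : ℕ} (n : ℕ) [NeZero n] (M : Fin d → ℕ) [hM : ∀ μ, NeZero (M μ)]

/-- «A([x, x(b)])», `b = ⟨y, y + e_μ⟩`, `x(b) = x + e_μ`: «A(Γ) = Σ_{b⊂Γ} A_b» over the straight
contour of `n` fine bonds from `x` to `x + e_μ`. [cite: Balaban1984PropagatorsI, (1.18) p.20] -/
def lineSum (A : Tor (fine n M) × Fin d → ℂ) (x : Tor (fine n M)) (μ : Fin d) : ℂ :=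
  ∑ t : Fin n, A (x + tstep (fine n M) μ t, μ)

/-- «(Q′_kλ)(y) = Σ_{x∈B^k(y)} η^dλ(x)» as a matrix `T₁^{(k)} ← T_η`.
[cite: Balaban1984PropagatorsI, (1.20) p.20] -/
def QsOp : Matrix (Tor M) (Tor (fine n M)) ℂ :=
  fun y x => ∑ j : Fin d → Fin n, if x = bpt n M y j then 1 / (n : ℂ) ^ d else 0

/-- `(Q′_k f)(y) = η^d Σ_{j} f(ny + j)`. [cite: Balaban1984PropagatorsI, (1.20) p.20] -/
theorem QsOp_mulVec (f : Tor (fine n M) → ℂ) (y : Tor M) :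
    (QsOp n M *ᵥ f) y = 1 / (n : ℂ) ^ d * ∑ j : Fin d → Fin n, f (bpt n M y j) := by
  simp only [Matrix.mulVec, dotProduct, QsOp, Finset.sum_mul, ite_mul, zero_mul]
  rw [Finset.sum_comm, Finset.mul_sum]
  refine Finset.sum_congr rfl fun j _ => ?_
  simp only [Finset.sum_ite_eq', Finset.mem_univ, if_true]

/-- (1.18) «(Q_kA)_b = Σ_{x∈B^k(b₋)} η^{d+1}A([x, x(b)])», `b = ⟨y, y+e_μ⟩ ↔ (y, μ)`, as a matrix on
vector fields `T₁^{(k)} × {1..d} ← T_η × {1..d}`. [cite: Balaban1984PropagatorsI, (1.18) p.20] -/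
def QvOp : Matrix (Tor M × Fin d) (Tor (fine n M) × Fin d) ℂ :=
  fun b i => if i.2 = b.2 then
    ∑ j : Fin d → Fin n, ∑ t : Fin n,
      (if i.1 = bpt n M b.1 j + tstep (fine n M) b.2 t then 1 / (n : ℂ) ^ (d + 1) else 0)
    else 0

/-- `(Q_k A)_{⟨y,y+e_μ⟩} = η^{d+1} Σ_{x∈B^k(y)} A([x, x+e_μ])`.
[cite: Balaban1984PropagatorsI, (1.18) p.20] -/
theorem QvOp_mulVec (A : Tor (fine n M) × Fin d → ℂ) (y : Tor M) (μ : Fin d) :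
    (QvOp n M *ᵥ A) (y, μ) = 1 / (n : ℂ) ^ (d + 1) * ∑ j : Fin d → Fin n, lineSum n M A (bpt n M y j) μ := by
  simp only [Matrix.mulVec, dotProduct, QvOp, lineSum]
  rw [Fintype.sum_prod_type]
  simp only [ite_mul, zero_mul, Finset.sum_ite_eq', Finset.mem_univ, if_true, Finset.sum_mul]
  rw [Finset.sum_comm, Finset.mul_sum]
  refine Finset.sum_congr rfl fun j _ => ?_
  rw [Finset.sum_comm, Finset.mul_sum]
  refine Finset.sum_congr rfl fun t _ => ?_
  simp only [Finset.sum_ite_eq', Finset.mem_univ, if_true]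

/-- `∂^η` telescopes along `[x, x + e_μ]`: `A([x,x+e_μ])` for `A^λ = A − ∂^ηλ` loses
`n(λ(x + e_μ) − λ(x))·η⁻¹`-weighted endpoint terms. [cite: Balaban1984PropagatorsI, (1.20) p.20] -/
theorem lineSum_gaugeT (A : Tor (fine n M) × Fin d → ℂ) (l : Tor (fine n M) → ℂ)
    (x : Tor (fine n M)) (μ : Fin d) :
    lineSum n M (gaugeT (fine n M) (n : ℂ) A l) x μ
      = lineSum n M A x μ - (n : ℂ) * (l (x + tstep (fine n M) μ n) - l x) := by
  simp only [lineSum, gaugeT, Pi.sub_apply, GradOp_mulVec, sdiff_mulVec, Finset.sum_sub_distrib]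
  congr 1
  rw [← Finset.mul_sum]
  congr 1
  simp_rw [add_assoc, ← tstep_succ]
  rw [sum_fin_telescope (fun t => l (x + tstep (fine n M) μ t)) n]
  simp [tstep_zero]

omit [NeZero n] hM in
/-- `B^k(y) + e_μ = B^k(y + e_μ)` pointwise («x(b) is a point in B^k(b₊) obtained from x by
translation by b»). [cite: Balaban1984PropagatorsI, (1.18) p.20] -/
theorem bpt_add_tstep (y : Tor M) (j : Fin d → Fin n) (μ : Fin d) :
    bpt n M y j + tstep (fine n M) μ n = bpt n M (y + unitVec M μ) j := by
  simp only [bpt, up_add, up_unitVec]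
  abel

/-- (1.20): «(Q_kA^λ)_b = (Q_kA)_b − (Σ_{x∈B^k(b₊)} η^dλ(x) − Σ_{x∈B^k(b₋)} η^dλ(x))».
[cite: Balaban1984PropagatorsI, (1.20) p.20] -/
theorem QvOp_gaugeT (A : Tor (fine n M) × Fin d → ℂ) (l : Tor (fine n M) → ℂ) (y : Tor M)
    (μ : Fin d) :
    (QvOp n M *ᵥ gaugeT (fine n M) (n : ℂ) A l) (y, μ)
      = (QvOp n M *ᵥ A) (y, μ) - ((QsOp n M *ᵥ l) (y + unitVec M μ) - (QsOp n M *ᵥ l) y) := by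
  have hnc : (n : ℂ) ≠ 0 := by exact_mod_cast NeZero.ne n
  simp only [QvOp_mulVec, QsOp_mulVec, lineSum_gaugeT, bpt_add_tstep]
  rw [Finset.sum_sub_distrib, ← Finset.mul_sum, Finset.sum_sub_distrib]
  field_simp
  ring

/-- (1.20), operator form: «Q_kA^λ = Q_kA − ∂Q′_kλ» (the unit-lattice gradient `∂`, factor `1`).
[cite: Balaban1984PropagatorsI, (1.20) p.20] -/
theorem QvOp_gaugeT_eq (A : Tor (fine n M) × Fin d → ℂ) (l : Tor (fine n M) → ℂ) :
    QvOp n M *ᵥ gaugeT (fine n M) (n : ℂ) A l = QvOp n M *ᵥ A - GradOp M 1 *ᵥ (QsOp n M *ᵥ l) := by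
  funext ⟨y, μ⟩
  rw [Pi.sub_apply, GradOp_mulVec, sdiff_mulVec, one_mul, QvOp_gaugeT]

end Averages

/-! ## §5. The momentum representations (1.30) (of `Q′_k`) and (1.61) (of `Q_k`) -/

section Momentum

variable {d : ℕ} (n : ℕ) [NeZero n] (M : Fin d → ℕ) [hM : ∀ μ, NeZero (M μ)]

/-- the normalisation constant `c = |T₁|^{-1/2} |T_η|^{-1/2} |T₁|` of the pair of unitary DFTs
(`= (√(n^d))⁻¹`, `cQ_eq`; equal to `1` in B5's conventions (1.29)). [folklore] -/
def cQ : ℝ := cT M * cT (fine n M) * Fintype.card (Tor M)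

/-- `c = 1/√(n^d)`. [folklore] -/
theorem cQ_eq : cQ n M = (Real.sqrt ((n : ℝ) ^ d))⁻¹ := by
  have ha : (0 : ℝ) < Fintype.card (Tor M) := by exact_mod_cast Fintype.card_pos
  have hn0 : (0 : ℝ) < n := by exact_mod_cast Nat.pos_of_ne_zero (NeZero.ne n)
  have hb : (0 : ℝ) < (n : ℝ) ^ d := pow_pos hn0 d
  have h1 : Real.sqrt ((n : ℝ) ^ d * Fintype.card (Tor M))
      = Real.sqrt ((n : ℝ) ^ d) * Real.sqrt (Fintype.card (Tor M)) := Real.sqrt_mul hb.le _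
  have h2 : Real.sqrt (Fintype.card (Tor M) : ℝ) * Real.sqrt (Fintype.card (Tor M) : ℝ)
      = Fintype.card (Tor M) := Real.mul_self_sqrt ha.le
  unfold cQ cT
  rw [card_fine, h1, mul_inv]
  calc (Real.sqrt (Fintype.card (Tor M) : ℝ))⁻¹
        * ((Real.sqrt ((n : ℝ) ^ d))⁻¹ * (Real.sqrt (Fintype.card (Tor M) : ℝ))⁻¹)
        * (Fintype.card (Tor M) : ℝ)
      = ((Real.sqrt (Fintype.card (Tor M) : ℝ) * Real.sqrt (Fintype.card (Tor M) : ℝ))⁻¹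
          * (Fintype.card (Tor M) : ℝ)) * (Real.sqrt ((n : ℝ) ^ d))⁻¹ := by
        rw [mul_inv]
        ring
    _ = (Real.sqrt ((n : ℝ) ^ d))⁻¹ := by rw [h2, inv_mul_cancel₀ ha.ne', one_mul]

/-- MASTER IDENTITY: the unit-lattice transform of a shifted block sum,
`Σ_y F¹_{p′,y} Σ_j g(ny + j + w) = c·n^d Σ_l u(p′+l) e^{i(p′+l)·w} ĝ(p′+l)`
(Fourier inversion of `g` on `T_η`; `Σ_y` = character orthogonality on `T₁`; `Σ_j` = `n^d u`).
[folklore] -/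
theorem master (g : Tor (fine n M) → ℂ) (q : Tor M) (w : Tor (fine n M)) :
    ∑ y, dft M q y * ∑ j : Fin d → Fin n, g (bpt n M y j + w)
      = (cQ n M : ℂ) * (n : ℂ) ^ d * ∑ k : Fin d → Fin n,
          uSym n k (sOf M q) * chi (fine n M) (pOf n M (k, q)) w
            * (dft (fine n M) *ᵥ g) (pOf n M (k, q)) := by
  -- Fourier inversion of `g`, summed along the coset parametrisation `p = p′ + l`
  have hexp : ∀ (y : Tor M) (j : Fin d → Fin n), g (bpt n M y j + w)
      = ∑ kq : (Fin d → Fin n) × Tor M, (cT (fine n M) : ℂ) * (chi M kq.2 y *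
          (chi (fine n M) (pOf n M kq) (iota n M j) * chi (fine n M) (pOf n M kq) w)) *
          (dft (fine n M) *ᵥ g) (pOf n M kq) := by
    intro y j
    rw [dft_inversion (fine n M) g (bpt n M y j + w),
      ← (pOf_bijective n M).sum_comp
        (fun p => conj (dft (fine n M) p (bpt n M y j + w)) * (dft (fine n M) *ᵥ g) p)]
    refine Finset.sum_congr rfl fun kq _ => ?_
    rcases kq with ⟨k, q'⟩
    simp only
    rw [conj_dft, bpt, chi_add_right, chi_add_right, chi_pOf_up]
    ring
  calc ∑ y, dft M q y * ∑ j : Fin d → Fin n, g (bpt n M y j + w)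
      = ∑ y, ∑ j : Fin d → Fin n, ∑ kq : (Fin d → Fin n) × Tor M,
          dft M q y * ((cT (fine n M) : ℂ) * (chi M kq.2 y *
            (chi (fine n M) (pOf n M kq) (iota n M j) * chi (fine n M) (pOf n M kq) w)) *
            (dft (fine n M) *ᵥ g) (pOf n M kq)) := by
        refine Finset.sum_congr rfl fun y _ => ?_
        rw [Finset.mul_sum]
        refine Finset.sum_congr rfl fun j _ => ?_
        rw [hexp, Finset.mul_sum]
    _ = ∑ y, ∑ kq : (Fin d → Fin n) × Tor M, ∑ j : Fin d → Fin n,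
          dft M q y * ((cT (fine n M) : ℂ) * (chi M kq.2 y *
            (chi (fine n M) (pOf n M kq) (iota n M j) * chi (fine n M) (pOf n M kq) w)) *
            (dft (fine n M) *ᵥ g) (pOf n M kq)) :=
        Finset.sum_congr rfl fun y _ => Finset.sum_comm
    _ = ∑ kq : (Fin d → Fin n) × Tor M, ∑ y, ∑ j : Fin d → Fin n,
          dft M q y * ((cT (fine n M) : ℂ) * (chi M kq.2 y *
            (chi (fine n M) (pOf n M kq) (iota n M j) * chi (fine n M) (pOf n M kq) w)) *
            (dft (fine n M) *ᵥ g) (pOf n M kq)) := Finset.sum_comm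
    _ = ∑ kq : (Fin d → Fin n) × Tor M, (cT (fine n M) : ℂ) * (dft (fine n M) *ᵥ g) (pOf n M kq)
          * chi (fine n M) (pOf n M kq) w *
          ((∑ y, dft M q y * chi M kq.2 y) *
            (∑ j : Fin d → Fin n, chi (fine n M) (pOf n M kq) (iota n M j))) := by
        refine Finset.sum_congr rfl fun kq _ => ?_
        rw [Finset.sum_mul_sum, Finset.mul_sum]
        refine Finset.sum_congr rfl fun y _ => ?_
        rw [Finset.mul_sum]
        refine Finset.sum_congr rfl fun j _ => ?_
        ring
    _ = ∑ kq : (Fin d → Fin n) × Tor M, (cT (fine n M) : ℂ) * (dft (fine n M) *ᵥ g) (pOf n M kq)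
          * chi (fine n M) (pOf n M kq) w *
          (((cT M : ℂ) * (if kq.2 = q then (Fintype.card (Tor M) : ℂ) else 0)) *
            ((n : ℂ) ^ d * uSym n kq.1 (sOf M kq.2))) := by
        refine Finset.sum_congr rfl fun kq _ => ?_
        rcases kq with ⟨k, q'⟩
        congr 2
        · rw [← sum_conj_chi_mul_chi, Finset.mul_sum]
          refine Finset.sum_congr rfl fun y _ => ?_
          rw [dft_apply', mul_assoc]
        · exact sum_chi_iota n M k q'
    _ = (cQ n M : ℂ) * (n : ℂ) ^ d * ∑ k : Fin d → Fin n,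
          uSym n k (sOf M q) * chi (fine n M) (pOf n M (k, q)) w
            * (dft (fine n M) *ᵥ g) (pOf n M (k, q)) := by
        rw [Fintype.sum_prod_type, Finset.mul_sum]
        refine Finset.sum_congr rfl fun k _ => ?_
        rw [Finset.sum_eq_single q]
        · rw [if_pos rfl, cQ]
          push_cast
          ring
        · intro q' _ hq'
          rw [if_neg hq']
          ring
        · intro h
          exact absurd (Finset.mem_univ q) h

/-- (1.30), second equation's left side = THE MOMENTUM REPRESENTATION OF `Q′_k`:
`(Q′_k f)^(p′) = c · Σ_l u_k(p′+l) f^(p′+l)` with `u_k = uSym` of `B5Prop11Fiber` and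
`c = (√(n^d))⁻¹` (`cQ_eq`). [cite: Balaban1984PropagatorsI, (1.30) p.23] -/
theorem dft_QsOp (f : Tor (fine n M) → ℂ) (q : Tor M) :
    (dft M *ᵥ (QsOp n M *ᵥ f)) q
      = (cQ n M : ℂ) * ∑ k : Fin d → Fin n,
          uSym n k (sOf M q) * (dft (fine n M) *ᵥ f) (pOf n M (k, q)) := by
  have hnc : (n : ℂ) ≠ 0 := by exact_mod_cast NeZero.ne n
  have hQ : QsOp n M *ᵥ f = fun y => 1 / (n : ℂ) ^ d * ∑ j : Fin d → Fin n, f (bpt n M y j) :=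
    funext (QsOp_mulVec n M f)
  have hL : (dft M *ᵥ (QsOp n M *ᵥ f)) q
      = 1 / (n : ℂ) ^ d * ∑ y, dft M q y * ∑ j : Fin d → Fin n, f (bpt n M y j + 0) := by
    rw [hQ]
    simp only [Matrix.mulVec, dotProduct, add_zero]
    rw [Finset.mul_sum]
    refine Finset.sum_congr rfl fun y _ => ?_
    ring
  have hm := master n M f q 0
  simp only [chi_zero_right, mul_one] at hm
  rw [hL, hm]
  field_simp

/-- (1.61) = THE MOMENTUM REPRESENTATION OF `Q_k`: «(Q_k A)~_μ(p′) = Σ_l u(p′+l) v_μ(p′+l)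
Ã_μ(p′+l), v_μ(p) = ∂¹_μ(p′)/∂_μ(p)», here with the constant `c = (√(n^d))⁻¹` and
`u = uSym`, `v_μ = vSym … μ` of `B5Prop11Fiber`; `comp A μ` is the component `A_μ` ((1.1)).
[cite: Balaban1984PropagatorsI, (1.61) p.28] -/
theorem dft_QvOp (A : Tor (fine n M) × Fin d → ℂ) (q : Tor M) (μ : Fin d) :
    (dft M *ᵥ comp M (QvOp n M *ᵥ A) μ) q
      = (cQ n M : ℂ) * ∑ k : Fin d → Fin n,
          uSym n k (sOf M q) * vSym n k (sOf M q) μ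
            * (dft (fine n M) *ᵥ comp (fine n M) A μ) (pOf n M (k, q)) := by
  have hnc : (n : ℂ) ≠ 0 := by exact_mod_cast NeZero.ne n
  have hQ : comp M (QvOp n M *ᵥ A) μ
      = fun y => 1 / (n : ℂ) ^ (d + 1) * ∑ j : Fin d → Fin n, lineSum n M A (bpt n M y j) μ :=
    funext fun y => QvOp_mulVec n M A y μ
  -- the position-space side, with `Σ_t` outermost
  have hL : (dft M *ᵥ comp M (QvOp n M *ᵥ A) μ) q
      = 1 / (n : ℂ) ^ (d + 1) * ∑ t : Fin n, ∑ y, dft M q y *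
          ∑ j : Fin d → Fin n, comp (fine n M) A μ (bpt n M y j + tstep (fine n M) μ t) := by
    rw [hQ]
    simp only [Matrix.mulVec, dotProduct, lineSum, comp]
    simp_rw [Finset.mul_sum]
    -- LHS: Σ_y Σ_j Σ_t,  RHS: Σ_t Σ_y Σ_j
    conv_rhs => rw [Finset.sum_comm]
    refine Finset.sum_congr rfl fun y _ => ?_
    conv_rhs => rw [Finset.sum_comm]
    refine Finset.sum_congr rfl fun j _ => ?_
    refine Finset.sum_congr rfl fun t _ => ?_
    ring
  rw [hL]
  simp_rw [master, chi_pOf_tstep]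
  rw [← Finset.mul_sum, Finset.sum_comm]
  have hk : ∀ k : Fin d → Fin n,
      ∑ t : Fin n, uSym n k (sOf M q) * om n k (sOf M q) μ ^ (t : ℕ)
          * (dft (fine n M) *ᵥ comp (fine n M) A μ) (pOf n M (k, q))
        = (n : ℂ) * (uSym n k (sOf M q) * vSym n k (sOf M q) μ
          * (dft (fine n M) *ᵥ comp (fine n M) A μ) (pOf n M (k, q))) := by
    intro k
    rw [← Finset.sum_mul, ← Finset.mul_sum, avg_om]
    ring
  simp_rw [hk]
  rw [← Finset.mul_sum]
  field_simp
  ring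

end Momentum

end

end Literature.MathematicalPhysics.QuantumFieldTheory.Balaban1983to89.B5Block118
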